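import Summits.BirchSwinnertonDyer.BirchSwinnertonDyer.Theorems.TameQuarticManinParityManinTorsionAnyGroup
import Literature.NumberTheory.EllipticCurves.ModularFormsGamma0Genus
import HarnessLib

/-!
# Characters of `Γ₀(N)` killing cusp stabilisers and ALL elliptic elements factor through the period lattice
# `H₁(X₀(N), ℤ) ⊂ S₂(Γ₀(N))^∨` — for ANY coefficient group (towards Knapp's Prop. 11.22; crux MS
# `TprimeIrrModThreeSaturation`, stmt-BirchSwinnertonDyer-23367, line `abelian-fixed-points`, lead g3; helper 2 of 3)

This is §1–§2 of the landed `…ThetaLayerLambdaCongruenceAtTwoParabolicCharacterFactor` (width seat of the `ℓ = 2`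
programme) VERBATIM, with the hypothesis «`R` has no `3`-torsion» replaced by «the character also kills the order-`3`/`6`
elliptic elements» (`γk = k·ST⁻¹`): the `τ`-fixed vanishing now comes from `maninSymbol_eq_neg_maninCusp_of_tauFixed` and
the torsion lemma from `sum_smul_eq_zero_of_mul_eq_relation'` (both `…TameQuarticManinParityManinTorsionAnyGroup`).  Inputs
otherwise unchanged: universal Manin chains (`exists_maninChain`), the coset Manin system (`cosetSystem_*`), exactness of
Manin's presentation over `ℚ` (`ker_msymbolMap_inf_ker_bdryMap_eq_relModule`) with the genus THEOREM
`twelve_mul_finrank_cuspForm_two_gamma0_holds`, the symbol function of a cusp character (`exists_maninFunction_of_cuspCharacter`).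
* `periods_eq_zero_of_periodFunctionals_eq_zero_of_ellipticPeriods'`, `character_sum_eq_zero_of_periodFunctionals_eq_zero'`,
  `character_eq_of_periodFunctional_eq'`, `exists_addMonoidHom_periodHomology_of_cuspCharacter'`.
THEOREMS ONLY; no definition, no named fact, no `sorry`; nothing about any curve is asserted; BSD is NOT proved.

References: [Manin1972] §1.5–1.7, Thm. 1.6, Thm. 1.9; [Knapp1993] Prop. 11.22; [ShimuraIATAF1971] §8.2; [CremonaAlgorithms1997] §2.1–2.2.
-/

set_option autoImplicit false

-- D-0017: single-problem summit, so `Summit.BirchSwinnertonDyer.BirchSwinnertonDyer.…` repeats a namespace BY DESIGN.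
set_option linter.dupNamespace false

noncomputable section

open scoped Classical MatrixGroups

open CongruenceSubgroup Matrix.SpecialLinearGroup ModularGroup
open Literature.NumberTheory.EllipticCurves.ModularForms
open Summit.BirchSwinnertonDyer.BirchSwinnertonDyer.Theorems.ThetaLayerLambdaCongruenceAtTwo

namespace Summit.BirchSwinnertonDyer.BirchSwinnertonDyer.Theorems.TameQuarticManinParity

/-! ## Characters killing cusp stabilisers and ALL elliptic elements factor through the period lattice
(the landed `…ParabolicCharacterFactor`, minus the `3`-torsion hypothesis) -/

section Factor

variable {R : Type} [AddCommGroup R] {N : ℕ} [NeZero N] {Φ : ℚ → R}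

/-- **B1 in an arbitrary additive group.** `Φ : ℚ → R` a Γ₀(N)-symbol function (cocycle identity `hM`) whose
elliptic periods of BOTH kinds vanish: `Φ(δ·∞) = 0` whenever `δk = kS` (order `4`) or `δk = k(ST⁻¹)` (order `3`, `6`) for
some `k ∈ SL₂(ℤ)`.  Then every integral relation `Σᵢ nᵢ·{∞, γᵢ∞} = 0` among period functionals (`γᵢ ∈ Γ₀(N)`) holds among
the periods of `Φ`: `Σᵢ nᵢ·Φ(γᵢ·∞) = 0`.  Proof = the landed `periods_eq_zero_of_periodFunctionals_eq_zero_of_ellipticPeriods`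
verbatim (universal Manin chains, exactness over `ℚ` by `ker_msymbolMap_inf_ker_bdryMap_eq_relModule` and the genus THEOREM
`twelve_mul_finrank_cuspForm_two_gamma0_holds`, clearing denominators), with the `τ`-fixed vanishing taken from
`maninSymbol_eq_neg_maninCusp_of_tauFixed` and the torsion lemma `sum_smul_eq_zero_of_mul_eq_relation'` — so NO hypothesis
on the torsion of `R`. [cite: Manin1972, Thm. 1.9] -/
theorem periods_eq_zero_of_periodFunctionals_eq_zero_of_ellipticPeriods'
    (hM : ∀ (γ : Gamma0 N) (r : ℚ), ((γ : SL(2, ℤ)) 1 0 : ℚ) * r + ((γ : SL(2, ℤ)) 1 1 : ℚ) ≠ 0 →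
      Φ ((((γ : SL(2, ℤ)) 0 0 : ℚ) * r + ((γ : SL(2, ℤ)) 0 1 : ℚ)) /
        (((γ : SL(2, ℤ)) 1 0 : ℚ) * r + ((γ : SL(2, ℤ)) 1 1 : ℚ))) =
        (if ((γ : SL(2, ℤ)) 1 0) = 0 then 0 else Φ ((((γ : SL(2, ℤ)) 0 0 : ℚ)) / (((γ : SL(2, ℤ)) 1 0 : ℚ)))) + Φ r)
    (hell : ∀ (δ : Gamma0 N) (k : SL(2, ℤ)), (δ : SL(2, ℤ)) * k = k * S →
      (if ((δ : SL(2, ℤ)) 1 0) = 0 then (0 : R) else Φ ((((δ : SL(2, ℤ)) 0 0 : ℚ)) / (((δ : SL(2, ℤ)) 1 0 : ℚ)))) = 0)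
    (hellτ : ∀ (δ : Gamma0 N) (k : SL(2, ℤ)), (δ : SL(2, ℤ)) * k = k * (S * T⁻¹) →
      (if ((δ : SL(2, ℤ)) 1 0) = 0 then (0 : R) else Φ ((((δ : SL(2, ℤ)) 0 0 : ℚ)) / (((δ : SL(2, ℤ)) 1 0 : ℚ)))) = 0)
    {ι : Type} [Fintype ι] (n : ι → ℤ) (γ : ι → Gamma0 N)
    (hrel : ∑ i, n i • periodFunctional N (γ i) = 0) :
    ∑ i, n i • (if (((γ i : Gamma0 N) : SL(2, ℤ)) 1 0) = 0 then 0 else Φ (((((γ i : Gamma0 N) : SL(2, ℤ)) 0 0 : ℚ)) / ((((γ i : Gamma0 N) : SL(2, ℤ)) 1 0 : ℚ)))) = 0 := by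
  have hgenus : twelve_mul_finrank_cuspForm_two (Gamma0 N) := twelve_mul_finrank_cuspForm_two_gamma0_holds N
  -- the Manin-symbol system of `Φ` on `SL₂(ℤ)` and its properties (landed files)
  set MS : SL(2, ℤ) → R := fun h ↦ (if (h 1 0) = 0 then 0 else Φ (((h 0 0 : ℚ)) / ((h 1 0 : ℚ)))) - (if ((h * S) 1 0) = 0 then 0 else Φ ((((h * S) 0 0 : ℚ)) / (((h * S) 1 0 : ℚ)))) with hMS
  have hinv : ∀ (δ : Gamma0 N) (h : SL(2, ℤ)), MS ((δ : SL(2, ℤ)) * h) = MS h := fun δ h ↦ by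
    simp only [hMS]; exact maninSymbol_gamma0_mul hM δ h
  have hnegMS : ∀ h, MS (-h) = MS h := fun h ↦ by simp only [hMS]; exact maninSymbol_neg Φ h
  have hSMS : ∀ h, MS (h * S) = -MS h := fun h ↦ by
    have := maninSymbol_two_term Φ h
    simp only [hMS]
    exact eq_neg_of_add_eq_zero_right this
  have hτm : (S * T⁻¹ : SL(2, ℤ)) = ⟨!![0, -1; 1, -1], by norm_num [Matrix.det_fin_two_of]⟩ := by
    apply Subtype.ext
    rw [coe_mul, coe_S, coe_T_inv]
    ext i j
    fin_cases i <;> fin_cases j <;> simp [Matrix.mul_apply, Fin.sum_univ_two]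
  have h3t : ∀ h, MS h + MS (h * (S * T⁻¹)) + MS (h * (S * T⁻¹) * (S * T⁻¹)) = 0 := fun h ↦ by
    have := maninSymbol_three_term Φ h
    simp only [hMS]
    rw [hτm]
    exact this
  have hσ : ∀ (δ : Gamma0 N) (h : SL(2, ℤ)), (δ : SL(2, ℤ)) * h = h * S → MS h = 0 := fun δ h hfix ↦ by
    simp only [hMS]
    rw [maninSymbol_eq_neg_maninCusp_of_sigmaFixed hM δ h hfix, hell δ h hfix, neg_zero]
  have hτ0 : ∀ (δ : Gamma0 N) (h : SL(2, ℤ)), (δ : SL(2, ℤ)) * h = h * (S * T⁻¹) → MS h = 0 := fun δ h hfix ↦ by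
    simp only [hMS]
    rw [maninSymbol_eq_neg_maninCusp_of_tauFixed hM δ h hfix, hellτ δ h hfix, neg_zero]
  -- the system on the coset space `X`
  set M : Gamma0Coset N → R := fun q ↦ MS (q.out)⁻¹ with hMdef
  have hM1 : ∀ q, M (S • q) = -M q := fun q ↦ cosetSystem_S MS hinv hnegMS hSMS q
  have hM2 : ∀ q, M q + M ((T * S) • q) + M ((T * S) • (T * S) • q) = 0 := fun q ↦
    cosetSystem_TS MS hinv hnegMS h3t q
  have hM3 : ∀ q, S • q = q → M q = 0 := fun q hq ↦ cosetSystem_S_fixed MS hinv hσ q hq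
  have hM4 : ∀ q, (T * S) • q = q → M q = 0 := fun q hq ↦ cosetSystem_TS_fixed MS hinv hτ0 q hq
  -- universal chains for the `γ i`
  choose L hL using fun i ↦ exists_maninChain.{0} ((γ i : Gamma0 N) : SL(2, ℤ))
  -- the integral chain `cZ = Σ nᵢ · chainVec (L i)` and its pairing identity
  set cZ : Gamma0Coset N → ℤ := fun q ↦
    ∑ i, n i * ((L i).map fun g ↦ (Pi.single ((g⁻¹ : SL(2, ℤ)) : Gamma0Coset N) (1 : ℤ) : Gamma0Coset N → ℤ)).sum q
    with hcZ
  have pair : ∀ {V : Type} [AddCommGroup V] (v : Gamma0Coset N → V),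
      ∑ q, cZ q • v q = ∑ i, n i • ((L i).map fun g ↦ v ((g⁻¹ : SL(2, ℤ)) : Gamma0Coset N)).sum := by
    intro V _ v
    simp only [hcZ, Finset.sum_smul, mul_smul]
    rw [Finset.sum_comm]
    refine Finset.sum_congr rfl fun i _ ↦ ?_
    rw [← sum_chainVec_smul v (L i), Finset.smul_sum]
  -- the rational chain `c`
  set c : Gamma0Coset N → ℚ := fun q ↦ (cZ q : ℚ) with hc
  have pairQ : ∀ {V : Type} [AddCommGroup V] [Module ℚ V] (v : Gamma0Coset N → V),
      ∑ q, c q • v q = ∑ i, n i • ((L i).map fun g ↦ v ((g⁻¹ : SL(2, ℤ)) : Gamma0Coset N)).sum := by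
    intro V _ _ v
    rw [← pair v]
    exact Finset.sum_congr rfl fun q _ ↦ Int.cast_smul_eq_zsmul ℚ (cZ q) (v q)
  -- `Ψ(c) = Σ nᵢ {∞, γᵢ∞} = 0`
  have hΨ : msymbolMap N c = 0 := by
    have e : msymbolMap N c = ∑ q, c q • msymbol N q := by
      rw [msymbolMap, Fintype.linearCombination_apply]
    rw [e, pairQ (msymbol N)]
    have e3 : ∀ i, ((L i).map fun g ↦ msymbol N ((g⁻¹ : SL(2, ℤ)) : Gamma0Coset N)).sum =
        periodFunctional N (γ i) := fun i ↦ by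
      rw [periodFunctional_eq_inftyFunctional, ← maninChain_sum_msymbolFunctional (hL i)]
      congr 1
      refine List.map_congr_left fun g _ ↦ ?_
      rw [msymbol_mk, inv_inv]
    simp_rw [e3]
    exact hrel
  -- `δ(c) = Σ nᵢ ([γᵢ∞] − [∞]) = 0`
  have hδ : bdryMap N c = 0 := by
    have e : bdryMap N c = ∑ q, c q • bdryVec N q := by
      rw [bdryMap, Fintype.linearCombination_apply]
    rw [e, pairQ (bdryVec N)]
    have e3 : ∀ i, ((L i).map fun g ↦ bdryVec N ((g⁻¹ : SL(2, ℤ)) : Gamma0Coset N)).sum = 0 := fun i ↦ by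
      have hb : ∀ g : SL(2, ℤ), bdryVec N ((g⁻¹ : SL(2, ℤ)) : Gamma0Coset N) =
          Pi.single (cuspOrbitOf N g) (1 : ℚ) - Pi.single (cuspOrbitOf N (g * S)) 1 := fun g ↦ by
        rw [bdryVec, cuspInfty_mk, inv_inv, MulAction.Quotient.smul_mk, smul_eq_mul, cuspInfty_mk, mul_inv_rev,
          inv_inv, inv_inv]
      simp_rw [hb]
      rw [maninChain_sum_cuspOrbitOf (hL i), ← mul_one ((γ i : Gamma0 N) : SL(2, ℤ)),
        cuspOrbitOf_mul_of_mem (γ i).2, sub_self]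
    simp_rw [e3, smul_zero, Finset.sum_const_zero]
  -- exactness over `ℚ`: `c ∈ Rel`
  have hcRel : c ∈ relModule N := by
    rw [← ker_msymbolMap_inf_ker_bdryMap_eq_relModule N hgenus]
    exact ⟨LinearMap.mem_ker.mpr hΨ, LinearMap.mem_ker.mpr hδ⟩
  obtain ⟨y, hy, z, hz, hyz⟩ := Submodule.mem_sup.mp hcRel
  obtain ⟨u, rfl⟩ := LinearMap.mem_range.mp hy
  obtain ⟨v, rfl⟩ := LinearMap.mem_range.mp hz
  -- clear denominators
  set D : ℕ := ∏ q, ((u q).den * (v q).den) with hD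
  have hD0 : D ≠ 0 := Finset.prod_ne_zero_iff.mpr fun q _ ↦ mul_ne_zero (u q).den_nz (v q).den_nz
  have hdu : ∀ q, (u q).den ∣ D := fun q ↦
    (Dvd.intro _ rfl : (u q).den ∣ (u q).den * (v q).den).trans (Finset.dvd_prod_of_mem _ (Finset.mem_univ q))
  have hdv : ∀ q, (v q).den ∣ D := fun q ↦
    (Dvd.intro_left _ rfl : (v q).den ∣ (u q).den * (v q).den).trans (Finset.dvd_prod_of_mem _ (Finset.mem_univ q))
  choose uZ huZ using fun q ↦ exists_int_cast_eq_natCast_mul (u q) D (hdu q)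
  choose vZ hvZ using fun q ↦ exists_int_cast_eq_natCast_mul (v q) D (hdv q)
  have hSS : ∀ q : Gamma0Coset N, S • S • q = q := fun q ↦ by
    rw [← mul_smul, S_mul_S_eq_neg_one, neg_one_smul_coset]
  have hTS3 : ∀ q : Gamma0Coset N, (T * S) • (T * S) • (T * S) • q = q := fun q ↦ by
    rw [← mul_smul, ← mul_smul, TS_pow_three_eq, neg_one_smul_coset]
  set AZ : Gamma0Coset N → ℤ := fun q ↦ uZ q + uZ (S • q) with hAZ'
  set BZ : Gamma0Coset N → ℤ := fun q ↦ vZ q + vZ ((T * S) • q) + vZ ((T * S) • (T * S) • q) with hBZ'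
  have hAZ : ∀ q, AZ (S • q) = AZ q := fun q ↦ by
    show uZ (S • q) + uZ (S • S • q) = uZ q + uZ (S • q)
    rw [hSS, add_comm]
  have hBZ : ∀ q, BZ ((T * S) • q) = BZ q := fun q ↦ by
    show vZ ((T * S) • q) + vZ ((T * S) • (T * S) • q) + vZ ((T * S) • (T * S) • (T * S) • q) =
      vZ q + vZ ((T * S) • q) + vZ ((T * S) • (T * S) • q)
    rw [hTS3]; abel
  have hrelZ : ∀ q, (D : ℤ) * cZ q = AZ q + BZ q + 0 := fun q ↦ by
    have e := congrFun hyz q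
    have e' : c q = (u q + u (S • q)) + (v q + v ((T * S) • q) + v ((T * S) • (T * S) • q)) := by
      rw [← e]
      simp only [relTwo, relThree, Pi.add_apply, LinearMap.add_apply, LinearMap.id_apply, LinearMap.comp_apply,
        cosetPerm_apply]
    apply Int.cast_injective (α := ℚ)
    rw [add_zero]
    push_cast
    rw [show ((cZ q : ℤ) : ℚ) = c q from rfl, e', show ((AZ q : ℤ) : ℚ) = (uZ q : ℚ) + (uZ (S • q) : ℚ) by
      simp only [hAZ']; push_cast; rfl, show ((BZ q : ℤ) : ℚ) = (vZ q : ℚ) + (vZ ((T * S) • q) : ℚ) +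
      (vZ ((T * S) • (T * S) • q) : ℚ) by simp only [hBZ']; push_cast; rfl, huZ, huZ, hvZ, hvZ, hvZ]
    ring
  -- the torsion lemma (no `3`-torsion hypothesis)
  have key := sum_smul_eq_zero_of_mul_eq_relation' (X := Gamma0Coset N) (fun q ↦ S • q) (fun q ↦ (T * S) • q)
    hSS hTS3 M hM1 hM2 hM3 hM4 cZ AZ BZ (fun _ ↦ 0) (D : ℤ) (by exact_mod_cast hD0) hAZ hBZ
    (fun q h ↦ (h rfl).elim) hrelZ
  rw [pair M] at key
  have e4 : ∀ i, ((L i).map fun g ↦ M ((g⁻¹ : SL(2, ℤ)) : Gamma0Coset N)).sum =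
      (if (((γ i : Gamma0 N) : SL(2, ℤ)) 1 0) = 0 then 0 else Φ (((((γ i : Gamma0 N) : SL(2, ℤ)) 0 0 : ℚ)) / ((((γ i : Gamma0 N) : SL(2, ℤ)) 1 0 : ℚ)))) := fun i ↦ by
    rw [← maninChain_sum_maninSymbol Φ (hL i)]
    congr 1
    refine List.map_congr_left fun g _ ↦ ?_
    show MS ((((g⁻¹ : SL(2, ℤ)) : Gamma0Coset N)).out)⁻¹ = _
    rw [apply_out_inv_mk MS hinv, inv_inv]
  simp_rw [e4] at key
  exact key

/-- **Relations among period functionals hold among the values of a cusp–elliptic character**, in ANY additive group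
`R`: `u : Γ₀(N) → R` additive, vanishing on the stabiliser of every cusp (`(k⁻¹γk)₁₀ = 0 ⇒ u γ = 0`), on the order-`4`
elliptic elements (`γk = kS`) and on the order-`3`/`6` elliptic elements (`γk = k(ST⁻¹)`).  Then `Σ nᵢ·{∞, γᵢ∞} = 0` in
`S₂(Γ₀(N))^∨` implies `Σ nᵢ·u(γᵢ) = 0`. [cite: Manin1972, Thm. 1.9] [cite: Knapp1993, Prop. 11.22 (PDF p. 242)] -/
theorem character_sum_eq_zero_of_periodFunctionals_eq_zero' (u : Gamma0 N → R)
    (hadd : ∀ γ δ : Gamma0 N, u (γ * δ) = u γ + u δ)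
    (hstab : ∀ (γ : Gamma0 N) (k : SL(2, ℤ)), (k⁻¹ * (γ : SL(2, ℤ)) * k) 1 0 = 0 → u γ = 0)
    (hell : ∀ (γ : Gamma0 N) (k : SL(2, ℤ)), (γ : SL(2, ℤ)) * k = k * S → u γ = 0)
    (hellτ : ∀ (γ : Gamma0 N) (k : SL(2, ℤ)), (γ : SL(2, ℤ)) * k = k * (S * T⁻¹) → u γ = 0)
    {ι : Type} [Fintype ι] (n : ι → ℤ) (γ : ι → Gamma0 N)
    (hrel : ∑ i, n i • periodFunctional N (γ i) = 0) :
    ∑ i, n i • u (γ i) = 0 := by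
  obtain ⟨Φ, hM, hcusp⟩ := exists_maninFunction_of_cuspCharacter u hadd hstab
  have hellΦ : ∀ (δ : Gamma0 N) (k : SL(2, ℤ)), (δ : SL(2, ℤ)) * k = k * S →
      (if ((δ : SL(2, ℤ)) 1 0) = 0 then (0 : R) else Φ ((((δ : SL(2, ℤ)) 0 0 : ℚ)) / (((δ : SL(2, ℤ)) 1 0 : ℚ)))) = 0 :=
    fun δ k h ↦ by rw [hcusp]; exact hell δ k h
  have hellτΦ : ∀ (δ : Gamma0 N) (k : SL(2, ℤ)), (δ : SL(2, ℤ)) * k = k * (S * T⁻¹) →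
      (if ((δ : SL(2, ℤ)) 1 0) = 0 then (0 : R) else Φ ((((δ : SL(2, ℤ)) 0 0 : ℚ)) / (((δ : SL(2, ℤ)) 1 0 : ℚ)))) = 0 :=
    fun δ k h ↦ by rw [hcusp]; exact hellτ δ k h
  have key := periods_eq_zero_of_periodFunctionals_eq_zero_of_ellipticPeriods' hM hellΦ hellτΦ n γ hrel
  simp_rw [hcusp] at key
  exact key

/-- **A cusp–elliptic character is constant on the fibres of the period map** `γ ↦ {∞, γ∞}` (any `R`).
[cite: Manin1972, Thm. 1.9] -/
theorem character_eq_of_periodFunctional_eq' (u : Gamma0 N → R)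
    (hadd : ∀ γ δ : Gamma0 N, u (γ * δ) = u γ + u δ)
    (hstab : ∀ (γ : Gamma0 N) (k : SL(2, ℤ)), (k⁻¹ * (γ : SL(2, ℤ)) * k) 1 0 = 0 → u γ = 0)
    (hell : ∀ (γ : Gamma0 N) (k : SL(2, ℤ)), (γ : SL(2, ℤ)) * k = k * S → u γ = 0)
    (hellτ : ∀ (γ : Gamma0 N) (k : SL(2, ℤ)), (γ : SL(2, ℤ)) * k = k * (S * T⁻¹) → u γ = 0)
    (γ δ : Gamma0 N) (h : periodFunctional N γ = periodFunctional N δ) : u γ = u δ := by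
  have hrel : ∑ i : Fin 2, (![1, -1] i) • periodFunctional N (![γ, δ] i) = 0 := by
    rw [Fin.sum_univ_two]
    simp [h]
  have key := character_sum_eq_zero_of_periodFunctionals_eq_zero' u hadd hstab hell hellτ _ _ hrel
  rw [Fin.sum_univ_two] at key
  simp only [Matrix.cons_val_zero, Matrix.cons_val_one, one_smul, neg_smul] at key
  exact sub_eq_zero.mp (by rw [sub_eq_add_neg]; exact key)

/-- **Factorisation through the period lattice, any coefficients.** A character `u : Γ₀(N) → R` (ANY additive group
`R`) vanishing on the cusp stabilisers and on all elliptic elements is `φ ∘ (γ ↦ {∞, γ∞})` for an additive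
`φ : Λ → R`, `Λ = periodHomology N`. [cite: Knapp1993, Prop. 11.22 (PDF p. 242)] [cite: Manin1972, Thm. 1.9] -/
theorem exists_addMonoidHom_periodHomology_of_cuspCharacter' (u : Gamma0 N → R)
    (hadd : ∀ γ δ : Gamma0 N, u (γ * δ) = u γ + u δ)
    (hstab : ∀ (γ : Gamma0 N) (k : SL(2, ℤ)), (k⁻¹ * (γ : SL(2, ℤ)) * k) 1 0 = 0 → u γ = 0)
    (hell : ∀ (γ : Gamma0 N) (k : SL(2, ℤ)), (γ : SL(2, ℤ)) * k = k * S → u γ = 0)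
    (hellτ : ∀ (γ : Gamma0 N) (k : SL(2, ℤ)), (γ : SL(2, ℤ)) * k = k * (S * T⁻¹) → u γ = 0) :
    ∃ φ : periodHomology N →+ R, ∀ γ : Gamma0 N,
      φ ⟨periodFunctional N γ, periodFunctional_mem_periodHomology N γ⟩ = u γ := by
  have hwd := character_eq_of_periodFunctional_eq' u hadd hstab hell hellτ
  -- every element of `Λ` is a single period functional
  have hsurj : ∀ x : periodHomology N, ∃ γ : Gamma0 N, periodFunctional N γ = (x : Module.Dual ℂ (CuspForm (Gamma0 N) 2)) :=
    fun x ↦ by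
      have hx : (x : Module.Dual ℂ (CuspForm (Gamma0 N) 2)) ∈ (periodHomology N : Set (Module.Dual ℂ (CuspForm (Gamma0 N) 2))) :=
        x.2
      rw [coe_periodHomology_eq_range] at hx
      exact hx
  choose sec hsec using hsurj
  have hu1 : u 1 = 0 := by
    have h := hadd 1 1
    rw [one_mul] at h
    exact left_eq_add.mp h
  refine ⟨{ toFun := fun x ↦ u (sec x), map_zero' := ?_, map_add' := ?_ }, ?_⟩
  · show u (sec 0) = 0
    rw [hwd (sec 0) 1 (by rw [hsec, periodFunctional_one]; rfl), hu1]
  · intro x y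
    show u (sec (x + y)) = u (sec x) + u (sec y)
    rw [← hadd]
    refine hwd _ _ ?_
    rw [periodFunctional_mul, hsec, hsec, hsec]
    rfl
  · intro γ
    show u (sec _) = u γ
    exact hwd _ _ (by rw [hsec])

end Factor

end Summit.BirchSwinnertonDyer.BirchSwinnertonDyer.Theorems.TameQuarticManinParity

end
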